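import Summits.AtomisticToContinuum.HydrodynamicLimit.Theorems.AntiMazurCoboundariesCellForecastPressureDecayEnskogObjectsB
import Summits.AtomisticToContinuum.HydrodynamicLimit.Theorems.AntiMazurCoboundariesCellForecastPressureDecayKinematicAssemblyFreshPair
import HarnessLib

/-!
# S2d′ · kinematic assembly from the cluster tail, piece 1: the pathwise bookkeeping of a slab
# (registered sub-goal `stub_kinematicAssemblyOfTail_pathwise` of stub `stub_kinematicAssemblyOfTail`, crux line
# `enskog-compensator-martingale`, crux `CellForecastPressureDecay`, stmt-AtomisticToContinuum-13915)

The deterministic bookkeeping behind `KinematicRates σ` (stub S2d′): along the whole-cell flow of a good datum `z`,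
the one-slab increment `∑ᵢ [w(vᵢ(Δ)) − w(vᵢ(0))]` equals one half of the double sum over ordered pairs `i ≠ j` of the
static pair functional `φ_{vᵢ,vⱼ}(xᵢ − xⱼ)` of `stub_kinematicAssembly_mainTerm`, up to an error controlled by the two
counting functions of the cluster tail `ClusterTail σ`:

`|∑ᵢ Jᵢ − ½ ∑_{i≠j} φᵢⱼ| ≤ 2b · #{i : neither free nor in an isolated pair} + 2b · #{(i,j) : i ≠ j, in the cylinder, not isolated}`.

* `abs_sum_sub_half_sum_le` — the pure combinatorics: labels are free (`Jᵢ = 0`), bad, or in a UNIQUE isolated pair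
  (two distinct isolated partners force freedom), and an isolated pair contributes `Jᵢ + Jⱼ = φᵢⱼ`;
* `stub_kinematicAssemblyOfTail_pathwise` — the registered form along `(Ψ n).flow` for every family `φ` with the
  on/off-cylinder clauses of `stub_kinematicAssembly_mainTerm` (pieces `…NoCollision`, `…IsolatedPair`, `…FreshPair`).

References: Cercignani–Illner–Pulvirenti 1994, §4.2; Gallagher–Saint-Raymond–Texier 2013, §4.1.
-/

noncomputable section

open MeasureTheory ProbabilityTheory Set Filter Topology
open scoped ENNReal BigOperators InnerProductSpace
open Literature.Analysis.FluidPDE Literature.MathematicalPhysics.KineticTheory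

namespace Summit.AtomisticToContinuum.HydrodynamicLimit.Theorems.EnskogCompensator

/-! ## Elementary facts on free spheres and isolated pairs -/

section Basic

variable {σ : ℝ} {n : ℕ} {Ψ : Flows σ} {Δ : ℝ} {z : Cell n} {i j j' : Fin n}

/-- Isolation of a pair is symmetric. [folklore] -/
theorem IsIsolatedPair.symm (h : IsIsolatedPair Ψ Δ z i j) : IsIsolatedPair Ψ Δ z j i :=
  ⟨h.1.symm, h.2.2, h.2.1⟩

/-- A sphere with two distinct isolated partners takes part in no collision of the slab. [folklore] -/
theorem IsIsolatedPair.isFreeIn_of_ne (h : IsIsolatedPair Ψ Δ z i j) (h' : IsIsolatedPair Ψ Δ z i j')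
    (hjj' : j ≠ j') : IsFreeIn Ψ Δ z i := by
  rintro s hs ⟨k, hk⟩
  exact hjj' ((h.2.1 s hs k hk).symm.trans (h'.2.1 s hs k hk))

end Basic

/-! ## The combinatorial bookkeeping -/

/-- **The bookkeeping of a slab (pure combinatorics).** Labels `i` carry increments `Jᵢ` (`|Jᵢ| ≤ 2b`), ordered pairs
carry `Φᵢⱼ` (`|Φᵢⱼ| ≤ 4b`); free labels have `Jᵢ = 0`, an isolated pair has `Jᵢ + Jⱼ = Φᵢⱼ`, isolation is
symmetric, irreflexive, and two distinct isolated partners force freedom; `Φᵢⱼ ≠ 0` only on cylinder pairs. Then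
`|∑ᵢ Jᵢ − ½ ∑_{i≠j} Φᵢⱼ| ≤ 2b #S + 2b #T` for any `S ⊇ {bad labels}` and `T ⊇ {non-isolated cylinder pairs}`. [folklore] -/
theorem abs_sum_sub_half_sum_le {n : ℕ} {J : Fin n → ℝ} {Φ : Fin n → Fin n → ℝ} {Free : Fin n → Prop}
    {Iso Cyl : Fin n → Fin n → Prop} {b : ℝ}
    (hpair : ∀ i j, Iso i j → J i + J j = Φ i j) (hfree : ∀ i, Free i → J i = 0)
    (hsymm : ∀ i j, Iso i j → Iso j i) (huniq : ∀ i j j', Iso i j → Iso i j' → j ≠ j' → Free i)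
    (hirr : ∀ i j, Iso i j → i ≠ j) (hcyl : ∀ i j, i ≠ j → Φ i j ≠ 0 → Cyl i j)
    (hJ : ∀ i, |J i| ≤ 2 * b) (hΦ : ∀ i j, |Φ i j| ≤ 4 * b) (hb : 0 ≤ b)
    (S : Finset (Fin n)) (hS : ∀ i, ¬ (Free i ∨ ∃ j, Iso i j) → i ∈ S)
    (T : Finset (Fin n × Fin n)) (hT : ∀ p : Fin n × Fin n, p.1 ≠ p.2 → Cyl p.1 p.2 → ¬ Iso p.1 p.2 → p ∈ T) :
    |(∑ i, J i) - (1 / 2) * ∑ i, ∑ j, (if i = j then 0 else Φ i j)| ≤ 2 * b * S.card + 2 * b * T.card := by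
  classical
  -- the bad labels
  set Bad : Fin n → Prop := fun i => ¬ (Free i ∨ ∃ j, Iso i j) with hBad
  -- every label is free, bad, or in a unique isolated pair
  have key : ∀ i, J i * ((Finset.univ.filter fun j => Iso i j).card : ℝ) = if Bad i then 0 else J i := by
    intro i
    by_cases hf : Free i
    · have hnb : ¬ Bad i := fun h => h (Or.inl hf)
      rw [if_neg hnb, hfree i hf, zero_mul]
    · by_cases hex : ∃ j, Iso i j
      · obtain ⟨j, hj⟩ := hex
        have hcard : (Finset.univ.filter fun j => Iso i j) = {j} := by
          ext j'
          simp only [Finset.mem_filter, Finset.mem_univ, true_and, Finset.mem_singleton]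
          refine ⟨fun hj' => ?_, fun h => h ▸ hj⟩
          by_contra hne
          exact hf (huniq i j j' hj hj' (Ne.symm hne))
        have hnb : ¬ Bad i := fun h => h (Or.inr ⟨j, hj⟩)
        rw [hcard, if_neg hnb, Finset.card_singleton, Nat.cast_one, mul_one]
      · have hB : Bad i := fun h => h.elim hf hex
        have hcard : (Finset.univ.filter fun j => Iso i j) = ∅ := by
          ext j'
          simp only [Finset.mem_filter, Finset.mem_univ, true_and, Finset.notMem_empty, iff_false]
          exact fun h => hex ⟨j', h⟩
        rw [hcard, if_pos hB, Finset.card_empty, Nat.cast_zero, mul_zero]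
  -- the isolated part of the pair sum is twice the non-bad increments
  have hIso : ∑ i, ∑ j, (if Iso i j then Φ i j else 0) = 2 * ∑ i, (if Bad i then 0 else J i) := by
    have h1 : ∀ i j, (if Iso i j then Φ i j else 0) = (if Iso i j then J i else 0) + (if Iso i j then J j else 0) := by
      intro i j
      split_ifs with h
      · rw [← hpair i j h]
      · simp
    have h2 : ∑ i, ∑ j, (if Iso i j then J j else 0) = ∑ i, ∑ j, (if Iso i j then J i else 0) := by
      rw [Finset.sum_comm]
      refine Finset.sum_congr rfl fun i _ => Finset.sum_congr rfl fun j _ => ?_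
      have : Iso j i ↔ Iso i j := ⟨hsymm j i, hsymm i j⟩
      simp only [this]
    have h3 : ∀ i, ∑ j, (if Iso i j then J i else 0) = J i * ((Finset.univ.filter fun j => Iso i j).card : ℝ) := by
      intro i
      rw [Finset.sum_ite, Finset.sum_const_zero, add_zero, Finset.sum_const, nsmul_eq_mul, mul_comm]
    calc ∑ i, ∑ j, (if Iso i j then Φ i j else 0)
        = ∑ i, ∑ j, ((if Iso i j then J i else 0) + (if Iso i j then J j else 0)) :=
          Finset.sum_congr rfl fun i _ => Finset.sum_congr rfl fun j _ => h1 i j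
      _ = (∑ i, ∑ j, (if Iso i j then J i else 0)) + ∑ i, ∑ j, (if Iso i j then J j else 0) := by
          rw [← Finset.sum_add_distrib]
          exact Finset.sum_congr rfl fun i _ => Finset.sum_add_distrib
      _ = 2 * ∑ i, ∑ j, (if Iso i j then J i else 0) := by rw [h2]; ring
      _ = 2 * ∑ i, (if Bad i then 0 else J i) := by
          congr 1
          exact Finset.sum_congr rfl fun i _ => by rw [h3, key]
  -- splitting the full pair sum into its isolated and its non-isolated cylinder parts
  have hsplit : ∀ i j, (if i = j then 0 else Φ i j) =
      (if Iso i j then Φ i j else 0) + (if (i ≠ j ∧ Cyl i j ∧ ¬ Iso i j) then Φ i j else 0) := by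
    intro i j
    by_cases hij : i = j
    · subst hij
      have h1 : ¬ Iso i i := fun h => hirr i i h rfl
      simp [h1]
    · rw [if_neg hij]
      by_cases hI : Iso i j
      · rw [if_pos hI, if_neg (fun h => h.2.2 hI), add_zero]
      · rw [if_neg hI, zero_add]
        by_cases hC : Cyl i j
        · rw [if_pos ⟨hij, hC, hI⟩]
        · have h0 : Φ i j = 0 := by
            by_contra h
            exact hC (hcyl i j hij h)
          rw [h0]
          simp
  set A : ℝ := ∑ i, (if Bad i then J i else 0) with hA
  set B : ℝ := ∑ i, ∑ j, (if (i ≠ j ∧ Cyl i j ∧ ¬ Iso i j) then Φ i j else 0) with hB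
  have hJsum : ∑ i, J i = (1 / 2) * (∑ i, ∑ j, (if Iso i j then Φ i j else 0)) + A := by
    rw [hIso]
    have h : ∀ i, J i = (if Bad i then 0 else J i) + (if Bad i then J i else 0) := fun i => by
      split_ifs <;> simp
    rw [Finset.sum_congr rfl fun i _ => h i, Finset.sum_add_distrib]
    ring
  have hfull : ∑ i, ∑ j, (if i = j then 0 else Φ i j) = (∑ i, ∑ j, (if Iso i j then Φ i j else 0)) + B := by
    rw [hB, ← Finset.sum_add_distrib]
    refine Finset.sum_congr rfl fun i _ => ?_
    rw [← Finset.sum_add_distrib]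
    exact Finset.sum_congr rfl fun j _ => hsplit i j
  have hdiff : (∑ i, J i) - (1 / 2) * ∑ i, ∑ j, (if i = j then 0 else Φ i j) = A - (1 / 2) * B := by
    rw [hJsum, hfull]
    ring
  -- the two error terms
  have hAle : |A| ≤ 2 * b * S.card := by
    calc |A| ≤ ∑ i, |(if Bad i then J i else 0)| := Finset.abs_sum_le_sum_abs _ _
      _ ≤ ∑ i, (if i ∈ S then 2 * b else 0) := Finset.sum_le_sum fun i _ => by
          by_cases hBi : Bad i
          · rw [if_pos hBi, if_pos (hS i hBi)]
            exact hJ i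
          · rw [if_neg hBi, abs_zero]
            split_ifs <;> linarith
      _ = 2 * b * S.card := by
          rw [Finset.sum_ite_mem, Finset.univ_inter, Finset.sum_const, nsmul_eq_mul, mul_comm]
  have hBle : |B| ≤ 4 * b * T.card := by
    rw [hB, ← Fintype.sum_prod_type']
    calc |∑ p : Fin n × Fin n, (if (p.1 ≠ p.2 ∧ Cyl p.1 p.2 ∧ ¬ Iso p.1 p.2) then Φ p.1 p.2 else 0)|
        ≤ ∑ p : Fin n × Fin n, |(if (p.1 ≠ p.2 ∧ Cyl p.1 p.2 ∧ ¬ Iso p.1 p.2) then Φ p.1 p.2 else 0)| :=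
          Finset.abs_sum_le_sum_abs _ _
      _ ≤ ∑ p : Fin n × Fin n, (if p ∈ T then 4 * b else 0) := Finset.sum_le_sum fun p _ => by
          by_cases hp : p.1 ≠ p.2 ∧ Cyl p.1 p.2 ∧ ¬ Iso p.1 p.2
          · rw [if_pos hp, if_pos (hT p hp.1 hp.2.1 hp.2.2)]
            exact hΦ p.1 p.2
          · rw [if_neg hp, abs_zero]
            split_ifs <;> linarith
      _ = 4 * b * T.card := by
          rw [Finset.sum_ite_mem, Finset.univ_inter, Finset.sum_const, nsmul_eq_mul, mul_comm]
  rw [hdiff]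
  calc |A - 1 / 2 * B| ≤ |A| + |1 / 2 * B| := abs_sub _ _
    _ = |A| + 1 / 2 * |B| := by rw [abs_mul, abs_of_pos (by norm_num : (0 : ℝ) < 1 / 2)]
    _ ≤ 2 * b * S.card + 2 * b * T.card := by linarith

/-! ## The registered sub-goal: the pathwise bookkeeping along the whole-cell flow -/

open Classical in
/-- **Registered sub-goal `stub_kinematicAssemblyOfTail_pathwise`** (piece of stub `stub_kinematicAssemblyOfTail`,
S2d′, of the line `enskog-compensator-martingale`): **the pathwise bookkeeping of a slab.** Along the whole-cell flow of
a good datum `z` (`σ > 0`, `Δ > 0`, `|w| ≤ b`), for every family `φ_{v,u}` of pair functionals taking the two-body jump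
of `w` on the collision cylinder of the slab and vanishing off it (the clauses of `stub_kinematicAssembly_mainTerm`,
`|φ| ≤ 4b`), the one-slab increment `∑ᵢ [w(vᵢ(Δ)) − w(vᵢ)]` equals `½ ∑_{i≠j} φ_{vᵢ,vⱼ}(xᵢ − xⱼ)` up to
`2b · #{i : neither free nor in an isolated pair} + 2b · #{(i,j) : i ≠ j, initial data in the cylinder, not isolated}`
— the two counting functions of `ClusterTail σ` (free spheres do not jump, an isolated pair jumps by exactly
`φ_{vᵢ,vⱼ}(xᵢ − xⱼ)`, two distinct isolated partners force freedom). [cite: CIP1994, §4.2] -/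
theorem stub_kinematicAssemblyOfTail_pathwise : ∀ (σ : ℝ) (n : ℕ) (Ψ : Flows σ) (z : Cell n), z ∈ (Ψ n).good → 0 < σ →
    ∀ (Δ b : ℝ) (w : V3 → ℝ) (φ : V3 → V3 → V3 → ℝ), 0 < Δ → (∀ v, |w v| ≤ b) → (∀ v u q, |φ v u q| ≤ 4 * b) →
      (∀ (v u : V3) (ω : Metric.sphere (0 : V3) 1) (t : ℝ), t ∈ Set.Ioc 0 Δ → inner ℝ (ω : V3) (v - u) < 0 →
        φ v u (σ • (ω : V3) - t • (v - u)) =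
          w (reflectVel (σ • (ω : V3)) (v, u)).1 + w (reflectVel (σ • (ω : V3)) (v, u)).2 - w v - w u) →
      (∀ (v u q : V3), (¬ ∃ (ω : Metric.sphere (0 : V3) 1) (t : ℝ), t ∈ Set.Ioc 0 Δ ∧
        inner ℝ (ω : V3) (v - u) < 0 ∧ q = σ • (ω : V3) - t • (v - u)) → φ v u q = 0) →
        |(∑ i, (w ((Ψ n).flow Δ z i).2 - w (z i).2)) -
            (1 / 2) * ∑ i, ∑ j, (if i = j then 0 else φ (z i).2 (z j).2 ((z i).1 - (z j).1))| ≤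
          2 * b * ((Finset.univ.filter fun i : Fin n =>
              ¬ (IsFreeIn Ψ Δ z i ∨ ∃ j, IsIsolatedPair Ψ Δ z i j)).card : ℝ) +
          2 * b * ((Finset.univ.filter fun p : Fin n × Fin n =>
              p.1 ≠ p.2 ∧ InCylinder σ Δ z p.1 p.2 ∧ ¬ IsIsolatedPair Ψ Δ z p.1 p.2).card : ℝ) := by
  intro σ n Ψ z hz hσ Δ b w φ hΔ hwb hφb hon hoff
  have hb : 0 ≤ b := (abs_nonneg _).trans (hwb 0)
  have h0 : (Ψ n).flow 0 z = z := (Ψ n).flow_zero z hz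
  refine abs_sum_sub_half_sum_le (J := fun i => w ((Ψ n).flow Δ z i).2 - w (z i).2)
    (Φ := fun i j => φ (z i).2 (z j).2 ((z i).1 - (z j).1)) (Free := fun i => IsFreeIn Ψ Δ z i)
    (Iso := fun i j => IsIsolatedPair Ψ Δ z i j) (Cyl := fun i j => InCylinder σ Δ z i j) (b := b)
    (fun i j hI => ?_) (fun i hi => ?_) (fun i j h => h.symm) (fun i j j' h h' hne => h.isFreeIn_of_ne h' hne)
    (fun i j h => h.ne) (fun i j _ hne => ?_) (fun i => ?_) (fun i j => hφb _ _ _) hb _ (fun i hi => ?_) _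
    (fun p h1 h2 h3 => ?_)
  · have h := isolatedPair_increment_eq Ψ hz hσ hI.1 hΔ hI.2.1 hI.2.2 (w := w) (φ := φ (z i).2 (z j).2)
      (hon (z i).2 (z j).2) (hoff (z i).2 (z j).2)
    linarith
  · have h := (stub_kinematicAssembly_noCollision σ n Ψ z hz i 0 Δ hΔ.le hi).2
    rw [h, h0, sub_self]
  · by_contra hC
    exact hne (hoff _ _ _ fun ⟨ω, t, ht, hωu, hq⟩ => hC ⟨ω, t, ht, hωu, hq⟩)
  · have h1 := hwb ((Ψ n).flow Δ z i).2
    have h2 := hwb (z i).2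
    calc |w ((Ψ n).flow Δ z i).2 - w (z i).2| ≤ |w ((Ψ n).flow Δ z i).2| + |w (z i).2| := abs_sub _ _
      _ ≤ 2 * b := by linarith
  · simpa using hi
  · simp only [Finset.mem_filter, Finset.mem_univ, true_and]
    exact ⟨h1, h2, h3⟩

end Summit.AtomisticToContinuum.HydrodynamicLimit.Theorems.EnskogCompensator

end
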